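import Summits.BirchSwinnertonDyer.BirchSwinnertonDyer.Theorems.KolyvaginRoadThreeMethod2Eigen
import Mathlib.Algebra.Group.Nat.Even
import HarnessLib

/-!
# Route `KolyvaginRoadThree`, deciding crux `ZhangSharpFrameAtThreeHL` (item stmt-BirchSwinnertonDyer-19574):
# (A6⁰) «non-zero Selmer rank at every GOOD even level» FROM PARITY — the see-saw flip at a good prime + 3-parity at
# the bottom level — instead of the rank-0 converse (cell `bsd-stepL`, OWNER seat `bsd-stepL-koly` g12;
# `--supports stmt-BirchSwinnertonDyer-19574`, helper for the registered stub `Method2.stub_levelRaisingAtThree` of v2u)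

WHY. The registered METHOD skeleton v2u (koly g12, `Cruxes/ZhangSharpFrameAtThreeHL`, namespace `…Method2`) asks in
`stub_levelRaisingAtThree` two things on GOOD levels (`GoodLevel W K n`: every prime of `n` has `Frob_q² ≠ 1` on
`E[3]`): (A1) rank lowering at one new good unipotent-admissible prime, and (A6⁰) «the total canonical Selmer rank
`dim SelQ n ⁺ + dim SelQ n ⁻` is non-zero at every good level of even cardinality». W. Zhang sources (A6⁰) to his
Thm. 7.1 (the rank-ZERO converse `Sel = 0 ⇒ L(g_n/K, 1) ≠ 0`, impossible at root number `−1`), which at `p = 3 ∥ N` is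
the cell's memo chain R-SU3 + B♭ — NOT print. This file records that (A6⁰) needs none of it: on good levels it is a
PARITY statement. Two inputs, both of printed∕kernel grade, entering as explicit hypothesis SHAPES:

* (FLIP) at a good prime `q ∉ n` with `insert q n` good, the total canonical rank changes by EXACTLY ONE:
  `r(insert q n) = r(n) ± 1`. This is the Poitou–Tate see-saw for the self-dual Selmer structures `F_n`, `F_{n q}`
  (they differ at the single place `q`, where `H¹(K_q, E[3]) = H¹_fin ⊕ H¹_ord` is a hyperbolic plane and the image of
  the `q`-relaxed Selmer group is one of the two Lagrangian lines) — W. Zhang Prop. 5.4 ∕ Gross–Parson Lemma 9, the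
  same input (P1) from which the ACCEL seat koly3a derives (A1); it is FALSE at scalar primes (koly g12
  `STUB-MISSTATED-3-19574-scalar.md`), whence the `GoodLevel` binder.
* (ODD) the bottom rank `dim_𝔽₃ Sel₃(E/K) = dim SelQ ∅ ⁺ + dim SelQ ∅ ⁻` (tree `finrank_selmer_eq_finrank_selQ_add`,
  zhang3-p1 p457405) is ODD — at a Hoffstein–Luo A1 frame: `E(K)` has rank one and `Ш(E/K)` is finite
  (Gross–Zagier–Kolyvagin), `E(K)[3] = 0` (ρ̄ onto), and `dim_𝔽₃ Ш(E/K)[3]` is even (Cassels–Tate); or the 3-parity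
  theorem (Dokchitser–Dokchitser ∕ Nekovář) directly.

THEOREMS (pure combinatorics + the landed eigen-dictionary; 0 defs, 0 facts, 0 `sorry`):
* `odd_iff_even_card_of_flip` — for any `r : Finset Q → ℕ`, any predicate `Good` closed under removing a prime, FLIP on
  good levels and `Odd (r ∅)` give `Odd (r n) ↔ Even #n` at every good level (induction on `n`);
* `ne_zero_of_flip_of_odd` — hence `r n ≠ 0` at every good level of even cardinality;
* `selQRank_ne_zero_on_goodLevel_of_flip_of_odd` — the instance `r n = dim SelQ n ⁺ + dim SelQ n ⁻`, `Good = GoodLevel W K`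
  (tree `GoodLevel.mono`): EXACTLY the (A6⁰) conjunct of `stub_levelRaisingAtThree` (v2u), from (FLIP) + (ODD);
* `selQRank_ne_zero_on_goodLevel_of_flip_of_odd_selmer` — the same with (ODD) stated on `Sel₃(E/K)` itself;
* `algEquiv_mul_self_eq_one` — bookkeeping: every `ℚ`-automorphism of an imaginary quadratic field is an involution
  (needed to apply the eigen-dictionary to the complex conjugation `c ≠ 1` the skeleton's `_of` produces).

HONEST FRAMING. Nothing about Heegner points or level raising is asserted; (FLIP) and (ODD) are hypotheses, the file
books nothing. Its point for the line: stub A = (A1) + (A6⁰) on good levels is reachable from PRINT-GRADE Galois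
cohomology ((P1) see-saw, sign-refined Čebotarev, 3-parity) — no modular form, no R-SU3, no B♭ —, so the deep
`p = 3 ∥ N` content of crux 19574 is confined to stub B. PARTITION: O2@3 (B10) × A1 × crux 19574 — none (helper toward a
registered stub; types nothing, closes nothing; T7).

References: [cite: WZhang2014, Prop. 5.4, Thm. 7.1, Thm. 9.2 (parity), §9 (9.1)–(9.2)] [cite: GrossLMS1991, §10]
[cite: BertoliniDarmon2005, §2.2–§2.3 (the local conditions at an admissible prime)].
-/

noncomputable section

open scoped Classical

namespace Summit.BirchSwinnertonDyer.Rank1Residual.X11b.Three.Koly.Method2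

open WeierstrassCurve NumberField IsDedekindDomain
  Literature.NumberTheory.EllipticCurves Literature.NumberTheory.GaloisRepresentations Module

/-! ## Abstract parity bookkeeping on good levels -/

section Abstract

variable {Q : Type*} [DecidableEq Q]

/-- **Parity law on good levels.** If the «rank» `r` changes by exactly one whenever a prime is inserted into a level
keeping it good (FLIP), goodness is inherited by sub-levels, and `r ∅` is odd, then at every good level `n`:
`r n` is odd iff `#n` is even. Induction on `n`. [folklore] -/
theorem odd_iff_even_card_of_flip (Good : Finset Q → Prop) (hmono : ∀ (n : Finset Q) (q : Q), Good (insert q n) → Good n)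
    (r : Finset Q → ℕ)
    (hflip : ∀ (n : Finset Q) (q : Q), Good (insert q n) → q ∉ n → r (insert q n) + 1 = r n ∨ r (insert q n) = r n + 1)
    (h0 : Odd (r ∅)) : ∀ n : Finset Q, Good n → (Odd (r n) ↔ Even n.card) := by
  intro n
  induction n using Finset.induction_on with
  | empty =>
    intro _
    simp only [Finset.card_empty, Even.zero, iff_true]
    exact h0
  | insert q n hq ih =>
    intro hg
    have hn := ih (hmono n q hg)
    rw [Finset.card_insert_of_notMem hq]
    rw [Nat.odd_iff, Nat.even_iff] at hn ⊢
    rcases hflip n q hg hq with h | h <;> omega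

/-- **Non-vanishing at good even levels**: under FLIP and `Odd (r ∅)`, `r n ≠ 0` at every good level of even
cardinality. [folklore] -/
theorem ne_zero_of_flip_of_odd (Good : Finset Q → Prop) (hmono : ∀ (n : Finset Q) (q : Q), Good (insert q n) → Good n)
    (r : Finset Q → ℕ)
    (hflip : ∀ (n : Finset Q) (q : Q), Good (insert q n) → q ∉ n → r (insert q n) + 1 = r n ∨ r (insert q n) = r n + 1)
    (h0 : Odd (r ∅)) : ∀ n : Finset Q, Good n → Even n.card → r n ≠ 0 := by
  intro n hg he h
  have hodd : Odd (r n) := (odd_iff_even_card_of_flip Good hmono r hflip h0 n hg).mpr he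
  rw [h] at hodd
  exact (Nat.not_odd_iff_even.mpr Even.zero) hodd

/-- **Parity is derived, on good levels** (the shape (A6) of the engine, relativised): under FLIP and `Odd (r ∅)`,
`r n` is odd at every good even level. [cite: WZhang2014, Thm. 9.2] -/
theorem odd_of_flip_of_odd (Good : Finset Q → Prop) (hmono : ∀ (n : Finset Q) (q : Q), Good (insert q n) → Good n)
    (r : Finset Q → ℕ)
    (hflip : ∀ (n : Finset Q) (q : Q), Good (insert q n) → q ∉ n → r (insert q n) + 1 = r n ∨ r (insert q n) = r n + 1)
    (h0 : Odd (r ∅)) : ∀ n : Finset Q, Good n → Even n.card → Odd (r n) :=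
  fun n hg he ↦ (odd_iff_even_card_of_flip Good hmono r hflip h0 n hg).mpr he

end Abstract

/-! ## The instance: canonical Selmer ranks of the method skeleton at good levels -/

variable (W : WeierstrassCurve ℚ) (K : Type) [Field K] [NumberField K] [W.IsGloballyMinimal] (c : K ≃ₐ[ℚ] K)

/-- **(A6⁰) of `stub_levelRaisingAtThree` (v2u) FROM PARITY.** If (FLIP) inserting a good prime into a good level
changes the total canonical rank `dim SelQ n ⁺ + dim SelQ n ⁻` by exactly one [Poitou–Tate see-saw at a prime with
`Frob_q² ≠ 1` on `E[3]`: Zhang Prop. 5.4 ∕ (9.1)–(9.2)], and (ODD) the bottom total rank is odd [3-parity at the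
frame], then the total canonical rank is non-zero at EVERY good level of even cardinality — verbatim the (A6⁰)
conjunct of the registered stub, with no rank-0 converse and no modular form. [cite: WZhang2014, Thm. 9.2 and
Prop. 5.4] -/
theorem selQRank_ne_zero_on_goodLevel_of_flip_of_odd [Module (ZMod 3) (V3 W K)]
    (hflip : ∀ (n : Finset {q // IsUAdmissiblePrime W K q}) (q : {q // IsUAdmissiblePrime W K q}),
      GoodLevel W K (insert q n) → q ∉ n →
      finrank (ZMod 3) (SelQ W K c (insert q n) true) + finrank (ZMod 3) (SelQ W K c (insert q n) false) + 1 =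
          finrank (ZMod 3) (SelQ W K c n true) + finrank (ZMod 3) (SelQ W K c n false) ∨
        finrank (ZMod 3) (SelQ W K c (insert q n) true) + finrank (ZMod 3) (SelQ W K c (insert q n) false) =
          finrank (ZMod 3) (SelQ W K c n true) + finrank (ZMod 3) (SelQ W K c n false) + 1)
    (hodd : Odd (finrank (ZMod 3) (SelQ W K c ∅ true) + finrank (ZMod 3) (SelQ W K c ∅ false))) :
    ∀ (n : Finset {q // IsUAdmissiblePrime W K q}), GoodLevel W K n → Even n.card →
      finrank (ZMod 3) (SelQ W K c n true) + finrank (ZMod 3) (SelQ W K c n false) ≠ 0 :=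
  ne_zero_of_flip_of_odd (GoodLevel W K) (fun n q hg ↦ GoodLevel.mono W K hg (Finset.subset_insert q n))
    (fun n ↦ finrank (ZMod 3) (SelQ W K c n true) + finrank (ZMod 3) (SelQ W K c n false)) hflip hodd

/-- **Parity at every good even level** (the engine's (A6) shape, relativised), from (FLIP) + (ODD).
[cite: WZhang2014, Thm. 9.2] -/
theorem odd_selQRank_on_goodLevel_of_flip_of_odd [Module (ZMod 3) (V3 W K)]
    (hflip : ∀ (n : Finset {q // IsUAdmissiblePrime W K q}) (q : {q // IsUAdmissiblePrime W K q}),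
      GoodLevel W K (insert q n) → q ∉ n →
      finrank (ZMod 3) (SelQ W K c (insert q n) true) + finrank (ZMod 3) (SelQ W K c (insert q n) false) + 1 =
          finrank (ZMod 3) (SelQ W K c n true) + finrank (ZMod 3) (SelQ W K c n false) ∨
        finrank (ZMod 3) (SelQ W K c (insert q n) true) + finrank (ZMod 3) (SelQ W K c (insert q n) false) =
          finrank (ZMod 3) (SelQ W K c n true) + finrank (ZMod 3) (SelQ W K c n false) + 1)
    (hodd : Odd (finrank (ZMod 3) (SelQ W K c ∅ true) + finrank (ZMod 3) (SelQ W K c ∅ false))) :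
    ∀ (n : Finset {q // IsUAdmissiblePrime W K q}), GoodLevel W K n → Even n.card →
      Odd (finrank (ZMod 3) (SelQ W K c n true) + finrank (ZMod 3) (SelQ W K c n false)) :=
  odd_of_flip_of_odd (GoodLevel W K) (fun n q hg ↦ GoodLevel.mono W K hg (Finset.subset_insert q n))
    (fun n ↦ finrank (ZMod 3) (SelQ W K c n true) + finrank (ZMod 3) (SelQ W K c n false)) hflip hodd

/-- **Every `ℚ`-automorphism of an imaginary quadratic field is an involution** (`|Aut(K/ℚ)| = [K : ℚ] = 2`).
[folklore] -/
theorem algEquiv_mul_self_eq_one (hK : IsImaginaryQuadratic K) (σ : K ≃ₐ[ℚ] K) : σ * σ = 1 := by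
  haveI : Algebra.IsQuadraticExtension ℚ K := ⟨hK.1⟩
  have hcard : Nat.card (K ≃ₐ[ℚ] K) = 2 := by rw [IsGalois.card_aut_eq_finrank, hK.1]
  haveI : Finite (K ≃ₐ[ℚ] K) := Nat.finite_of_card_ne_zero (by rw [hcard]; decide)
  have h : σ ^ Nat.card (K ≃ₐ[ℚ] K) = 1 := pow_card_eq_one'
  rw [hcard, pow_two] at h
  exact h

/-- **(A6⁰) of `stub_levelRaisingAtThree` (v2u) from (FLIP) and the 3-parity of `Sel₃(E/K)` itself**: for `K`
imaginary quadratic and any `ℚ`-automorphism `c` of `K`, (FLIP) on good levels and `dim_𝔽₃ Sel₃(E/K)` ODD give a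
non-zero total canonical rank at every good even level. (ODD) at a Hoffstein–Luo A1 frame: `rank E(K) = 1`, `Ш(E/K)`
finite with `dim_𝔽₃ Ш(E/K)[3]` even (Cassels–Tate), `E(K)[3] = 0`.) [cite: WZhang2014, Thm. 9.2]
[cite: GrossLMS1991, §10] -/
theorem selQRank_ne_zero_on_goodLevel_of_flip_of_odd_selmer [W.IsElliptic] [Module (ZMod 3) (V3 W K)]
    (hK : IsImaginaryQuadratic K)
    (hflip : ∀ (n : Finset {q // IsUAdmissiblePrime W K q}) (q : {q // IsUAdmissiblePrime W K q}),
      GoodLevel W K (insert q n) → q ∉ n →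
      finrank (ZMod 3) (SelQ W K c (insert q n) true) + finrank (ZMod 3) (SelQ W K c (insert q n) false) + 1 =
          finrank (ZMod 3) (SelQ W K c n true) + finrank (ZMod 3) (SelQ W K c n false) ∨
        finrank (ZMod 3) (SelQ W K c (insert q n) true) + finrank (ZMod 3) (SelQ W K c (insert q n) false) =
          finrank (ZMod 3) (SelQ W K c n true) + finrank (ZMod 3) (SelQ W K c n false) + 1)
    (hodd : Odd (finrank (ZMod 3)
      (AddSubgroup.toZModSubmodule 3 (selmerGroup (W.baseChange K) ((3 ^ 1 : ℕ) : ℤ))))) :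
    ∀ (n : Finset {q // IsUAdmissiblePrime W K q}), GoodLevel W K n → Even n.card →
      finrank (ZMod 3) (SelQ W K c n true) + finrank (ZMod 3) (SelQ W K c n false) ≠ 0 := by
  have hbot : Odd (finrank (ZMod 3) (SelQ W K c ∅ true) + finrank (ZMod 3) (SelQ W K c ∅ false)) := by
    rw [← finrank_selmer_eq_finrank_selQ_add W K hK c (algEquiv_mul_self_eq_one K hK c)]
    exact hodd
  exact selQRank_ne_zero_on_goodLevel_of_flip_of_odd W K c hflip hbot

/-- **(ODD) in `Nat.card` currency**: `#Sel₃(E/K) = 3 ^ k` with `k` odd gives the odd bottom rank.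
[cite: GrossLMS1991, §10] -/
theorem odd_finrank_selQ_empty_add_of_natCard_eq_pow [W.IsElliptic] [Module (ZMod 3) (V3 W K)]
    (hK : IsImaginaryQuadratic K) {k : ℕ} (hk : Odd k)
    (hcard : Nat.card (selmerGroup (W.baseChange K) ((3 ^ 1 : ℕ) : ℤ)) = 3 ^ k) :
    Odd (finrank (ZMod 3) (SelQ W K c ∅ true) + finrank (ZMod 3) (SelQ W K c ∅ false)) := by
  have h := natCard_selmer_eq_pow_finrank_selQ_add W K hK c (algEquiv_mul_self_eq_one K hK c)
  rw [hcard] at h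
  have hk' : k = finrank (ZMod 3) (SelQ W K c ∅ true) + finrank (ZMod 3) (SelQ W K c ∅ false) :=
    Nat.pow_right_injective (by norm_num : 2 ≤ 3) h
  rw [← hk']
  exact hk

end Summit.BirchSwinnertonDyer.Rank1Residual.X11b.Three.Koly.Method2

end
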